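import Mathlib
import HarnessLib

/-!
# Group-theoretic lemmas for es's STEP 2 (D6 of LEAD's `kummer_diamond` line card): homomorphisms from CYCLIC unit groups into an elementary
# abelian `2`-group take at most ONE non-trivial value; `(ℤ/p^b)ˣ` (`p` odd) and `(ℤ/2^c)ˣ` (`c ≤ 2`) are such; two such images never fill `(ℤ/2)²`
(route `ManinLocalTwoThree`, crux C2 `ManinOddAtFour` stmt-BirchSwinnertonDyer-22967; cell bsd-f2-manin, prover p2 gen 21; encoding-free nodes for D6 = MEMO-es §59.5
STEP 2 / PROOF-Ees185-186.md §4 («(ℤ/p^v)ˣ/□ ≅ ℤ/2, so im ϖ_Q has order ≤ 2», «(ℤ/2^k)ˣ/±1 cyclic», «both images contain v ≠ 0 and together span K of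
order 4, so one image is all of K … forces Q₁ = 2^a with ⌈a/2⌉ ≥ 3, i.e. a ≥ 5»); `--supports stmt-BirchSwinnertonDyer-22967`)

* `exists_forall_eq_one_or_eq_of_isCyclic` — `G` cyclic, `V` a commutative group of exponent `2`, `f : G →* V` ⟹ `∃ v, ∀ g, f g = 1 ∨ f g = v`;
* `exists_forall_eq_one_or_eq_units_zmod_prime_pow` — the case `G = (ZMod (p^b))ˣ`, `p` an odd prime (Mathlib `ZMod.isCyclic_units_of_prime_pow`);
* `exists_forall_eq_one_or_eq_units_zmod_two_pow_le_two` — the case `G = (ZMod (2^c))ˣ`, `c ≤ 2` (`(ℤ/1)ˣ, (ℤ/2)ˣ, (ℤ/4)ˣ` are cyclic);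
* `exists_ne_of_two_small_ranges` — if `f₁, f₂` each take at most the values `1, v` then some `w : V` with `w ≠ 1`, `w ≠ v` is NOT a product `f₁ g₁ * f₂ g₂`
  (so two such components cannot span a Klein four-group containing `w`).
UNCONDITIONAL; nothing about C2, Manin's conjecture or BSD is proved.  No definitions, no sorry. [folklore]
-/

set_option autoImplicit false
-- lint-debt: the directory name repeats the summit name (sibling precedent `ManinLocalTwoThreeFreyTwistParityNormalForms.lean`)
set_option linter.dupNamespace false

namespace Summit.BirchSwinnertonDyer.BirchSwinnertonDyer.Theorems.ManinLocalTwoThree.StepTwoGroup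

/-- **A homomorphism from a cyclic group into a group of exponent `2` takes at most one non-trivial value.** [folklore] -/
theorem exists_forall_eq_one_or_eq_of_isCyclic {G V : Type*} [Group G] [IsCyclic G] [CommGroup V]
    (hV : ∀ v : V, v * v = 1) (f : G →* V) : ∃ v : V, ∀ g : G, f g = 1 ∨ f g = v := by
  obtain ⟨g₀, hg₀⟩ := IsCyclic.exists_generator (α := G)
  refine ⟨f g₀, fun g ↦ ?_⟩
  obtain ⟨k, rfl⟩ := hg₀ g
  rw [map_zpow]
  -- `x ^ k ∈ {1, x}` for `x * x = 1`
  have hsq : f g₀ ^ (2 : ℤ) = 1 := by rw [zpow_two]; exact hV _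
  obtain ⟨j, hj | hj⟩ := Int.even_or_odd' k
  · left
    rw [hj, zpow_mul, hsq, one_zpow]
  · right
    rw [hj, zpow_add, zpow_mul, hsq, one_zpow, one_mul, zpow_one]

/-- **`(ℤ/p^b)ˣ → V` (`p` an odd prime, `V` of exponent `2`) takes at most one non-trivial value** (`(ℤ/p^b)ˣ` is cyclic).
[folklore] -/
theorem exists_forall_eq_one_or_eq_units_zmod_prime_pow {p : ℕ} (hp : p.Prime) (hp2 : p ≠ 2) (b : ℕ) {V : Type*} [CommGroup V]
    (hV : ∀ v : V, v * v = 1) (f : (ZMod (p ^ b))ˣ →* V) : ∃ v : V, ∀ g, f g = 1 ∨ f g = v := by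
  haveI : IsCyclic (ZMod (p ^ b))ˣ := ZMod.isCyclic_units_of_prime_pow p hp hp2 b
  exact exists_forall_eq_one_or_eq_of_isCyclic hV f

/-- **`(ℤ/2^c)ˣ → V` with `c ≤ 2` (`V` of exponent `2`) takes at most one non-trivial value** (`(ℤ/1)ˣ`, `(ℤ/2)ˣ`, `(ℤ/4)ˣ` are cyclic) — so a
surjection onto a Klein four-group from the `2`-part of the diamond character needs `⌈a/2⌉ ≥ 3`, i.e. `2⁵ ∣ N`. [folklore] -/
theorem exists_forall_eq_one_or_eq_units_zmod_two_pow_le_two {c : ℕ} (hc : c ≤ 2) {V : Type*} [CommGroup V]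
    (hV : ∀ v : V, v * v = 1) (f : (ZMod (2 ^ c))ˣ →* V) : ∃ v : V, ∀ g, f g = 1 ∨ f g = v := by
  haveI : IsCyclic (ZMod (2 ^ c))ˣ := by
    interval_cases c
    · exact ZMod.isCyclic_units_one
    · exact ZMod.isCyclic_units_two
    · exact ZMod.isCyclic_units_four
  exact exists_forall_eq_one_or_eq_of_isCyclic hV f

/-- **Two components with at most one non-trivial value each, THE SAME value `v`, never produce an element `w ∉ {1, v}`** — in a Klein four-group
`K = {1, v, w, vw}` the products `f₁ g₁ * f₂ g₂` then lie in `{1, v}` (`v * v = 1`). [folklore] -/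
theorem mul_ne_of_forall_eq_one_or_eq {G₁ G₂ V : Type*} [CommGroup V] (hV : ∀ v : V, v * v = 1) {v w : V} (hw1 : w ≠ 1) (hwv : w ≠ v)
    {f₁ : G₁ → V} {f₂ : G₂ → V} (h₁ : ∀ g, f₁ g = 1 ∨ f₁ g = v) (h₂ : ∀ g, f₂ g = 1 ∨ f₂ g = v) (g₁ : G₁) (g₂ : G₂) :
    f₁ g₁ * f₂ g₂ ≠ w := by
  rcases h₁ g₁ with e₁ | e₁ <;> rcases h₂ g₂ with e₂ | e₂ <;> rw [e₁, e₂]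
  · rw [one_mul]; exact hw1.symm
  · rw [one_mul]; exact hwv.symm
  · rw [mul_one]; exact hwv.symm
  · rw [hV]; exact hw1.symm

end Summit.BirchSwinnertonDyer.BirchSwinnertonDyer.Theorems.ManinLocalTwoThree.StepTwoGroup
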